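import Literature.Analysis.FluidPDE.ClassicalL2StabilityStrain
import Literature.Analysis.FluidPDE.OseenSliceConstUpperBound
import HarnessLib

/-!
# Sup-norm shadowing at the strain fee — NUMERAL version (slice constant `9.03` of
# `OseenSliceConstUpperBound` in place of `oseenSliceConst ℝ³`)

Analysis/FluidPDE proof file (theorems only; no definitions, no named facts, no `sorry`). Verbatim twin
of `ClassicalStrainSupShadowing.lean` with the tree's `Classical.choose` constant `oseenSliceConst ℝ³`
replaced by the explicit slice constant `9.03` (`norm_oseenSlice_le_explicit`, fc-prover-2 g9): the
initial layer uses `sup_stability_forced_free_sharp`, the terminal window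
`sup_stability_forced_smoothing_free_window_sharp`. With these the short-window condition
`(24 · 9.03 · (B_v + B_w))² h ≤ ν` and every constant of the a-priori shadowing estimate are NUMERALS
a certificate can evaluate; the exponential fee remains `e^{∫Γ}` (strain times).

* `norm_sub_le_of_strain_initialLayer_sharp` — `t ≤ h`:
  `‖w(t,x) − v(t,x)‖ ≤ 2 (D + 4 ν^{-3/4} h^{1/4} G₂) · exp (36 · 9.03² (B_v + B_w)² t / ν)`;
* `norm_sub_le_of_strain_window_sharp` — `h < t ≤ S`:
  `‖w(t,x) − v(t,x)‖ ≤ 2 ((E₀ + G₂ (t−h)) e^{∫₀^{t−h} Γ} ν^{-3/4} + 4 ν^{-3/4} G₂ h) h^{-3/4}`.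

References: Robinson–Rodrigo–Sadowski 2016, (6.3)/Thm. 6.10 and Thm. 9.1 [RobinsonRodrigoSadowski2016];
Leray 1934 §19 [Leray1934]; Dashti–Robinson 2008 Thm. 1 [DashtiRobinson2008].
-/

noncomputable section

open MeasureTheory Set Function Filter InnerProductSpace
open _root_.Topology
open scoped ENNReal NNReal ContDiff RealInnerProductSpace

namespace Literature.Analysis.FluidPDE

section Shadow

variable {ν S : ℝ}
  {v w g : ℝ → EuclideanSpace ℝ (Fin 3) → EuclideanSpace ℝ (Fin 3)}
  {q ϖ : ℝ → EuclideanSpace ℝ (Fin 3) → ℝ}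
  {Bv Bw Gb G₂r D E₀ h : ℝ} {Γ : ℝ → ℝ}

/-- `eLpNorm f 2 = ofReal √(∫‖f‖²)` for `f ∈ L²`. (Plumbing.) [folklore] -/
private theorem eLpNorm_two_eq_ofReal_sqrt_of_memLp {G : Type*} [NormedAddCommGroup G]
    {f : EuclideanSpace ℝ (Fin 3) → G} (hf : MemLp f 2 volume) :
    eLpNorm f 2 volume = ENNReal.ofReal (Real.sqrt (∫ x, ‖f x‖ ^ 2)) := by
  rw [MemLp.eLpNorm_eq_integral_rpow_norm (by norm_num) (by norm_num) hf, ENNReal.toReal_ofNat]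
  have : ∫ x, ‖f x‖ ^ (2 : ℝ) = ∫ x, ‖f x‖ ^ 2 :=
    integral_congr_ae (Eventually.of_forall fun x => Real.rpow_two _)
  rw [this, Real.sqrt_eq_rpow, one_div]

/-- A continuous slice with `eLpNorm ≤ ofReal G` has `∫‖·‖² ≤ G²`. (Plumbing.) [folklore] -/
private theorem integral_norm_sq_le_of_eLpNorm_le {f : EuclideanSpace ℝ (Fin 3) → EuclideanSpace ℝ (Fin 3)}
    (hf : Continuous f) {G : ℝ} (hG : 0 ≤ G) (h : eLpNorm f 2 volume ≤ ENNReal.ofReal G) :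
    ∫ x, ‖f x‖ ^ 2 ≤ G ^ 2 := by
  have hmem : MemLp f 2 volume := ⟨hf.aestronglyMeasurable, h.trans_lt ENNReal.ofReal_lt_top⟩
  rw [eLpNorm_two_eq_ofReal_sqrt_of_memLp hmem] at h
  have h1 : Real.sqrt (∫ x, ‖f x‖ ^ 2) ≤ G := (ENNReal.ofReal_le_ofReal_iff hG).1 h
  have h0 : 0 ≤ ∫ x, ‖f x‖ ^ 2 := integral_nonneg fun x => sq_nonneg _
  nlinarith [Real.sq_sqrt h0, Real.sqrt_nonneg (∫ x, ‖f x‖ ^ 2)]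

/-- **Initial layer.** For `0 ≤ t ≤ min(h, S)` the sup gap is controlled by the tree's sup-norm
Leray–Grönwall door on the slab `[0, t]`:
`‖w(t,x) − v(t,x)‖ ≤ 2 (D + 4 ν^{-3/4} h^{1/4} G₂) exp (36 · 9.03² (B_v + B_w)² t / ν)` (numeral form).
[cite: Leray1934, §19 (3.4)–(3.8)] [cite: DashtiRobinson2008, Thm. 1] -/
theorem norm_sub_le_of_strain_initialLayer_sharp (hν : 0 < ν)
    (hv : IsClassicalNSSolutionOn (Icc 0 S) ν 0 v q) (hw : IsClassicalNSSolutionOn (Icc 0 S) ν g w ϖ)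
    (hgc : Continuous (uncurry g)) (hGb : ∀ τ ∈ Icc 0 S, ∀ y, ‖g τ y‖ ≤ Gb)
    (hgdiv : ∀ τ ∈ Icc 0 S, IsWeaklyDivFree (g τ)) (hG₂r : 0 ≤ G₂r)
    (hg2 : ∀ τ ∈ Icc 0 S, eLpNorm (g τ) 2 volume ≤ ENNReal.ofReal G₂r)
    (hEv : ∃ C : ℝ≥0∞, C < ⊤ ∧ ∀ t ∈ Icc 0 S, ∫⁻ x, ‖v t x‖ₑ ^ 2 ≤ C)
    (hEw : ∃ C : ℝ≥0∞, C < ⊤ ∧ ∀ t ∈ Icc 0 S, ∫⁻ x, ‖w t x‖ₑ ^ 2 ≤ C)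
    (hBv : 0 < Bv) (hBw : 0 < Bw)
    (hbv : ∀ t ∈ Icc 0 S, ∀ y, ‖v t y‖ ≤ Bv) (hbw : ∀ t ∈ Icc 0 S, ∀ y, ‖w t y‖ ≤ Bw)
    (hD : ∀ y, ‖w 0 y - v 0 y‖ ≤ D) (hh : 0 < h)
    {t : ℝ} (ht : t ∈ Icc 0 S) (hth : t ≤ h) :
    ∀ x, ‖w t x - v t x‖ ≤
      2 * (D + 4 * ν ^ (-(3 / 4 : ℝ)) * h ^ (1 / 4 : ℝ) * G₂r) *
        Real.exp (36 * (9.03 : ℝ) ^ 2 * (Bv + Bw) ^ 2 / ν * t) := by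
  intro x
  have hD0 : 0 ≤ D := (norm_nonneg _).trans (hD 0)
  rcases eq_or_lt_of_le ht.1 with h0 | h0
  · -- `t = 0`
    rw [← h0, mul_zero, Real.exp_zero, mul_one]
    have h1 : 0 ≤ 4 * ν ^ (-(3 / 4 : ℝ)) * h ^ (1 / 4 : ℝ) * G₂r := by positivity
    linarith [hD x]
  -- restrict both solutions to `[0, t]`
  have hsub : Icc 0 t ⊆ Icc 0 S := Icc_subset_Icc le_rfl ht.2
  have hU : UniqueDiffOn ℝ (Icc 0 t) := uniqueDiffOn_Icc h0
  have hv' : IsClassicalNSSolutionOn (Icc 0 t) ν 0 v q := hv.mono hsub hU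
  have hw' : IsClassicalNSSolutionOn (Icc 0 t) ν g w ϖ := hw.mono hsub hU
  have hEv' : ∃ C : ℝ≥0∞, C < ⊤ ∧ ∀ s ∈ Icc 0 t, ∫⁻ x, ‖v s x‖ₑ ^ 2 ≤ C := by
    obtain ⟨C, hC, hb⟩ := hEv; exact ⟨C, hC, fun s hs => hb s (hsub hs)⟩
  have hEw' : ∃ C : ℝ≥0∞, C < ⊤ ∧ ∀ s ∈ Icc 0 t, ∫⁻ x, ‖w s x‖ₑ ^ 2 ≤ C := by
    obtain ⟨C, hC, hb⟩ := hEw; exact ⟨C, hC, fun s hs => hb s (hsub hs)⟩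
  have hmain := sup_stability_forced_free_sharp hν h0 hv' hw' hgc (fun τ hτ => hGb τ (hsub hτ))
    (fun τ hτ => hgdiv τ (hsub hτ)) hG₂r (fun τ hτ => hg2 τ (hsub hτ)) hEv' hEw' hBv hBw
    (fun s hs => hbv s (hsub hs)) (fun s hs => hbw s (hsub hs)) hD t ⟨h0.le, le_rfl⟩ x
  refine hmain.trans ?_
  have h1 : t ^ (1 / 4 : ℝ) ≤ h ^ (1 / 4 : ℝ) := Real.rpow_le_rpow h0.le hth (by norm_num)
  have h2 : 0 ≤ Real.exp (36 * (9.03 : ℝ) ^ 2 * (Bv + Bw) ^ 2 / ν * t) :=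
    Real.exp_nonneg _
  gcongr

/-- **Terminal window.** For `h < t ≤ S`: the `L²` gap at time `t − h` is at most
`(E₀ + G₂ (t−h)) e^{∫₀^{t−h} Γ}` (strain-rate `L²` stability, `l2_stability_strain_forced`, fee in
strain times), and the `L² → L^∞` smoothing on `[t − h, t]` (`sup_stability_forced_smoothing_free_window`,
SHORT: `(24 · 9.03 (B_v + B_w))² h ≤ ν`, numeral form) gives
`‖w(t,x) − v(t,x)‖ ≤ 2 ((E₀ + G₂ (t−h)) e^{∫₀^{t−h} Γ} ν^{-3/4} + 4 ν^{-3/4} G₂ h) h^{-3/4}`.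
[cite: RobinsonRodrigoSadowski2016, Thm. 6.10 (proof), (6.3); Thm. 9.1] [cite: Leray1934, §19 (3.4)–(3.8)]
[cite: DashtiRobinson2008, Thm. 1] -/
theorem norm_sub_le_of_strain_window_sharp (hν : 0 < ν) (hS : 0 < S)
    (hv : IsClassicalNSSolutionOn (Icc 0 S) ν 0 v q) (hw : IsClassicalNSSolutionOn (Icc 0 S) ν g w ϖ)
    (hgc : Continuous (uncurry g)) (hGb : ∀ τ ∈ Icc 0 S, ∀ y, ‖g τ y‖ ≤ Gb)
    (hgdiv : ∀ τ ∈ Icc 0 S, IsWeaklyDivFree (g τ)) (hG₂r : 0 ≤ G₂r)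
    (hg2 : ∀ τ ∈ Icc 0 S, eLpNorm (g τ) 2 volume ≤ ENNReal.ofReal G₂r)
    (hEv : ∃ C : ℝ≥0∞, C < ⊤ ∧ ∀ t ∈ Icc 0 S, ∫⁻ x, ‖v t x‖ₑ ^ 2 ≤ C)
    (hEw : ∃ C : ℝ≥0∞, C < ⊤ ∧ ∀ t ∈ Icc 0 S, ∫⁻ x, ‖w t x‖ₑ ^ 2 ≤ C)
    -- Tao's `L²`-Sobolev class, both solutions
    (hvS : HasBoundedSobolevNormsOn (Icc 0 S) v)
    (hvt : HasBoundedSobolevNormsOn (Icc 0 S) (FluidPDE.timeDerivWithin (Icc 0 S) v))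
    (hqS : ∀ n : ℕ, ∃ C' : ℝ≥0, ∀ t ∈ Icc 0 S, ∫⁻ x, ‖iteratedFDeriv ℝ n (q t) x‖ₑ ^ 2 ≤ C')
    (hwS : HasBoundedSobolevNormsOn (Icc 0 S) w)
    (hwt : HasBoundedSobolevNormsOn (Icc 0 S) (FluidPDE.timeDerivWithin (Icc 0 S) w))
    (hϖS : ∀ n : ℕ, ∃ C' : ℝ≥0, ∀ t ∈ Icc 0 S, ∫⁻ x, ‖iteratedFDeriv ℝ n (ϖ t) x‖ₑ ^ 2 ≤ C')
    (hBv : 0 < Bv) (hBw : 0 < Bw)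
    (hbv : ∀ t ∈ Icc 0 S, ∀ y, ‖v t y‖ ≤ Bv) (hbw : ∀ t ∈ Icc 0 S, ∀ y, ‖w t y‖ ≤ Bw)
    -- the strain majorant of the reference
    (hΓc : ContinuousOn Γ (Icc 0 S)) (hΓ0 : ∀ t ∈ Icc 0 S, 0 ≤ Γ t)
    (hΓ : ∀ t ∈ Icc 0 S, ∀ x ξ, -⟪ξ, fderiv ℝ (w t) x ξ⟫ ≤ Γ t * ‖ξ‖ ^ 2)
    -- the `L²` datum gap and the short window
    (hE₀ : 0 ≤ E₀) (hE0 : ∫ x, ‖v 0 x - w 0 x‖ ^ 2 ≤ E₀ ^ 2) (hh : 0 < h)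
    (hTs : (24 * (9.03 : ℝ) * (Bv + Bw)) ^ 2 * h ≤ ν)
    {t : ℝ} (ht : t ∈ Icc 0 S) (hth : h < t) :
    ∀ x, ‖w t x - v t x‖ ≤
      2 * ((E₀ + G₂r * (t - h)) * Real.exp (∫ s in (0 : ℝ)..(t - h), Γ s) * ν ^ (-(3 / 4 : ℝ)) +
          4 * ν ^ (-(3 / 4 : ℝ)) * G₂r * h) * h ^ (-(3 / 4 : ℝ)) := by
  intro x
  have ht0 : 0 < t := hh.trans hth
  have hsub : Icc 0 t ⊆ Icc 0 S := Icc_subset_Icc le_rfl ht.2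
  have hU : UniqueDiffOn ℝ (Icc 0 t) := uniqueDiffOn_Icc ht0
  -- ### Step 1: the `L²` gap at time `t - h` (strain-rate stability on `[0, S]`)
  have hfL2 : ∀ τ ∈ Icc 0 S, ∫⁻ x, ‖(0 : ℝ → EuclideanSpace ℝ (Fin 3) → EuclideanSpace ℝ (Fin 3)) τ x‖ₑ ^ 2 < ⊤ :=
    fun τ _ => by simp
  have hgslc : ∀ τ, Continuous (g τ) := fun τ => hgc.comp (continuous_const.prodMk continuous_id)
  have hgL2 : ∀ τ ∈ Icc 0 S, ∫⁻ x, ‖g τ x‖ₑ ^ 2 < ⊤ := by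
    intro τ hτ
    rw [lintegral_enorm_sq_eq_eLpNorm_two_sq]
    exact ENNReal.pow_lt_top ((hg2 τ hτ).trans_lt ENNReal.ofReal_lt_top)
  have hR : ∀ τ ∈ Icc 0 S, ∫ x, ‖(0 : ℝ → EuclideanSpace ℝ (Fin 3) → EuclideanSpace ℝ (Fin 3)) τ x - g τ x‖ ^ 2
      ≤ G₂r ^ 2 := by
    intro τ hτ
    have h1 : ∫ x, ‖(0 : ℝ → EuclideanSpace ℝ (Fin 3) → EuclideanSpace ℝ (Fin 3)) τ x - g τ x‖ ^ 2 =
        ∫ x, ‖g τ x‖ ^ 2 :=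
      integral_congr_ae (Eventually.of_forall fun x => by simp)
    rw [h1]
    exact integral_norm_sq_le_of_eLpNorm_le (hgslc τ) hG₂r (hg2 τ hτ)
  have hL2 := l2_stability_strain_forced hν hS hv hw hfL2 hgL2 hvS hvt hqS hwS hwt hϖS
    (G := Γ) (R := fun _ => G₂r) hΓc continuousOn_const hΓ0 (fun _ _ => hG₂r) hΓ hR
  set s := t - h with hs_def
  have hs0 : 0 ≤ s := by rw [hs_def]; linarith
  have hsS : s ∈ Icc 0 S := ⟨hs0, by rw [hs_def]; linarith [ht.2]⟩
  have hst : s < t := by rw [hs_def]; linarith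
  set Es : ℝ := (E₀ + G₂r * s) * Real.exp (∫ σ in (0 : ℝ)..s, Γ σ) with hEs_def
  have hEs0 : 0 ≤ Es := by rw [hEs_def]; positivity
  have hgap_s : Real.sqrt (∫ x, ‖v s x - w s x‖ ^ 2) ≤ Es := by
    have h1 := hL2 s hsS
    rw [intervalIntegral.integral_const, smul_eq_mul, sub_zero] at h1
    have h2 : Real.sqrt (∫ x, ‖v 0 x - w 0 x‖ ^ 2) ≤ E₀ := by
      calc Real.sqrt (∫ x, ‖v 0 x - w 0 x‖ ^ 2) ≤ Real.sqrt (E₀ ^ 2) := Real.sqrt_le_sqrt hE0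
        _ = E₀ := Real.sqrt_sq hE₀
    have h3 : (Real.sqrt (∫ x, ‖v 0 x - w 0 x‖ ^ 2) + s * G₂r) * Real.exp (∫ σ in (0 : ℝ)..s, Γ σ) ≤ Es := by
      rw [hEs_def]
      refine mul_le_mul_of_nonneg_right (by linarith) (Real.exp_nonneg _)
    exact h1.trans h3
  -- as an `eLpNorm` bound on `w s − v s`
  have hcw : Continuous (w s) := (hw.contDiff_velocity hsS).continuous
  have hcv : Continuous (v s) := (hv.contDiff_velocity hsS).continuous
  have hlt : ∫⁻ x, ‖w s x - v s x‖ₑ ^ 2 < ⊤ := by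
    obtain ⟨Cw, hCw, hbw'⟩ := hEw
    obtain ⟨Cv, hCv, hbv'⟩ := hEv
    exact lintegral_enorm_sq_lt_top_of_norm_le_add (fun x => norm_sub_le _ _) hcw.aestronglyMeasurable
      ((hbw' s hsS).trans_lt hCw) ((hbv' s hsS).trans_lt hCv)
  have hmem : MemLp (fun y => w s y - v s y) 2 volume :=
    ⟨(hcw.sub hcv).aestronglyMeasurable, eLpNorm_two_lt_top_of_lintegral_enorm_sq_lt_top hlt⟩
  have hEs : eLpNorm (fun y => w s y - v s y) 2 volume ≤ ENNReal.ofReal Es := by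
    rw [eLpNorm_two_eq_ofReal_sqrt_of_memLp hmem]
    refine ENNReal.ofReal_le_ofReal ?_
    have hsym : ∫ x, ‖w s x - v s x‖ ^ 2 = ∫ x, ‖v s x - w s x‖ ^ 2 :=
      integral_congr_ae (Eventually.of_forall fun x => by
        show ‖w s x - v s x‖ ^ 2 = ‖v s x - w s x‖ ^ 2
        rw [norm_sub_rev])
    rw [hsym]
    exact hgap_s
  -- ### Step 2: smoothing on the terminal window `[s, t]` of the slab `[0, t]`
  have hv' : IsClassicalNSSolutionOn (Icc 0 t) ν 0 v q := hv.mono hsub hU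
  have hw' : IsClassicalNSSolutionOn (Icc 0 t) ν g w ϖ := hw.mono hsub hU
  have hEv' : ∃ C : ℝ≥0∞, C < ⊤ ∧ ∀ τ ∈ Icc 0 t, ∫⁻ x, ‖v τ x‖ₑ ^ 2 ≤ C := by
    obtain ⟨C, hC, hb⟩ := hEv; exact ⟨C, hC, fun τ hτ => hb τ (hsub hτ)⟩
  have hEw' : ∃ C : ℝ≥0∞, C < ⊤ ∧ ∀ τ ∈ Icc 0 t, ∫⁻ x, ‖w τ x‖ₑ ^ 2 ≤ C := by
    obtain ⟨C, hC, hb⟩ := hEw; exact ⟨C, hC, fun τ hτ => hb τ (hsub hτ)⟩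
  have hts : t - s = h := by rw [hs_def]; ring
  have hTs' : (24 * (9.03 : ℝ) * (Bv + Bw)) ^ 2 * (t - s) ≤ ν := by
    rw [hts]; exact hTs
  have hwin := sup_stability_forced_smoothing_free_window_sharp hν hs0 hst hv' hw' hgc
    (fun τ hτ => hGb τ (hsub hτ)) (fun τ hτ => hgdiv τ (hsub hτ)) hG₂r (fun τ hτ => hg2 τ (hsub hτ))
    hEv' hEw' hBv hBw (fun τ hτ => hbv τ (hsub hτ)) (fun τ hτ => hbw τ (hsub hτ)) hTs' hEs0 hEs
    t ⟨hst, le_rfl⟩ x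
  rw [hts] at hwin
  refine hwin.trans (le_of_eq ?_)
  have hh14 : h ^ (1 / 4 : ℝ) * G₂r * h ^ (3 / 4 : ℝ) = G₂r * h := by
    have : h ^ (1 / 4 : ℝ) * h ^ (3 / 4 : ℝ) = h := by
      rw [← Real.rpow_add hh]; norm_num
    calc h ^ (1 / 4 : ℝ) * G₂r * h ^ (3 / 4 : ℝ) = G₂r * (h ^ (1 / 4 : ℝ) * h ^ (3 / 4 : ℝ)) := by ring
      _ = G₂r * h := by rw [this]
  rw [hEs_def, hs_def]
  have e1 : 4 * ν ^ (-(3 / 4 : ℝ)) * h ^ (1 / 4 : ℝ) * G₂r * h ^ (3 / 4 : ℝ) =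
      4 * ν ^ (-(3 / 4 : ℝ)) * G₂r * h := by
    calc 4 * ν ^ (-(3 / 4 : ℝ)) * h ^ (1 / 4 : ℝ) * G₂r * h ^ (3 / 4 : ℝ)
        = 4 * ν ^ (-(3 / 4 : ℝ)) * (h ^ (1 / 4 : ℝ) * G₂r * h ^ (3 / 4 : ℝ)) := by ring
      _ = 4 * ν ^ (-(3 / 4 : ℝ)) * (G₂r * h) := by rw [hh14]
      _ = 4 * ν ^ (-(3 / 4 : ℝ)) * G₂r * h := by ring
  rw [e1]

end Shadow

end Literature.Analysis.FluidPDE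

end
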